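import Summits.HodgeConjecture.HodgeConjecture.Theses.PeriodDeficiency
import Summits.HodgeConjecture.HodgeConjecture.Theses.PeriodsPolice
import Summits.HodgeConjecture.HodgeConjecture.Theorems.PeriodDeficiencyAssemblyOfSupports
import Literature.AlgebraicGeometry.HodgeTheory.HodgeStructureOfHodgeModel
import Literature.AlgebraicGeometry.HodgeTheory.ComplexConjugationHolds
import Literature.AlgebraicGeometry.HodgeTheory.RationalLattice
import Literature.AlgebraicGeometry.Motives.HodgeTensorFactsHolds
import Literature.AlgebraicGeometry.HodgeTheory.HodgeGenericQbarDescent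
import Literature.AlgebraicGeometry.HodgeTheory.QbarGenericPointsDense
import Literature.AlgebraicGeometry.HodgeTheory.AlgebraicityLocus

/-!
# Route PeriodDeficiency — `Assembly` (item stmt-HodgeConjecture-13787): exact logical position and
# trust base; the real-carrier closing without Lang's fact

`Assembly := QbarGenericIsHodgeGeneric → HodgeConjectureQbar → HodgeConjecture` is the thesis
implication of route `PeriodDeficiency`.  It is not pure logic over the route's items: its content
is the known but formally XL reduction filed separately as the support items
`ClassicalGeometricVHS` (stmt-HodgeConjecture-11597, construction) and `GenericityReduction`
(stmt-HodgeConjecture-11598).  This helper file records, sorry-free and against the route decls BY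
NAME:

* `periodDeficiency_genericityReduction_of_assembly : Assembly → GenericityReduction` (pure
  logic) and, with the tree's `periodDeficiency_assembly_of_supports`,
  `periodDeficiency_assembly_iff_genericityReduction : ClassicalGeometricVHS → (Assembly ↔
  GenericityReduction)` — modulo the construction item the two items are the same statement;
* `periodDeficiency_assembly_of_periodsPolice_qbarDescent : PeriodsPolice.QbarDescent → Assembly`
  — across routes, the assembly item is implied outright by the `QbarDescent` item of route
  `PeriodsPolice` (`HC(ℚ̄) → HC`, antecedent verbatim `HodgeConjectureQbar`): kill criterion (iii)
  of the route made formal;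
* (trust base of the item AS FILED, no new declaration needed: `periodDeficiency_assembly_of_supports`
  composed with the tree's `genericityReduction_of_three_facts` gives `Assembly` from item 11597 and
  the THREE named facts spreading out (Charles–Schnell §11.3.5), finite monodromy at Hodge-generic
  points (Baldi–Klingler–Ullmo §3.2), Voisin 2007 Prop. 1.7 — Lang's C4 ⇒ C7 fact being discharged
  in its generic-point case by `QbarGenericPointsDense`;)
* `hodgeConjecture_of_realCarrier_genericity_of_two_facts` — the REAL-CARRIER closing of the route
  (`Theorems.hodgeConjecture_of_realCarrier_genericity`, which needs no `BettiHodgeData` /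
  `GeometricVHSData`, hence no item 11597) with its Lang hypothesis and its `HodgeModelsExist`
  hypothesis discharged (`qbarGeneric_of_closure_base_pt_eq_univ`, `nonempty_hodgeModel_holds`):
  `HodgeConjecture` from spreading out, Voisin's mechanism, the real-carrier BKU statement, the
  real-carrier crux 4 and `HodgeConjectureQbar`.  This is what a real-carrier restatement
  `Assembly′ := HGQ′ → HodgeConjectureQbar → HodgeConjecture` of the item would rest on: two
  printed facts and the real-carrier BKU fact, nothing to construct.

Nothing here closes the item (landed `--supports stmt-HodgeConjecture-13787`).
-/

set_option linter.dupNamespace false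

noncomputable section

open CategoryTheory AlgebraicGeometry Topology
open Literature.AlgebraicGeometry.Motives Literature.AlgebraicGeometry.HodgeTheory
open Literature.AlgebraicTopology.SingularHomology

namespace Summit.HodgeConjecture.HodgeConjecture.Theorems

open Summit.HodgeConjecture.HodgeConjecture.Theses

/-! ### Logical position of the item -/

/-- **`Assembly` implies the support item `GenericityReduction`** (`GenericityReduction` is the
chain `ClassicalGeometricVHS → HGQ → HC(ℚ̄) → HodgeModelsExist → HodgeConjecture`; drop the first
and fourth hypotheses).  Pure logic: the assembly item is at least as strong as item
stmt-HodgeConjecture-11598. -/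
theorem periodDeficiency_genericityReduction_of_assembly (h : PeriodDeficiency.Assembly) :
    PeriodDeficiency.GenericityReduction := by
  unfold PeriodDeficiency.GenericityReduction
  intro _ hG hQ _
  exact h hG hQ

/-- **Modulo the construction item, `Assembly` and `GenericityReduction` coincide**:
`ClassicalGeometricVHS → (Assembly ↔ GenericityReduction)` (forward direction pure logic, backward
direction the tree's `periodDeficiency_assembly_of_supports`, which discharges `HodgeModelsExist`
by `nonempty_hodgeModel_holds`). -/
theorem periodDeficiency_assembly_iff_genericityReduction
    (hC : PeriodDeficiency.ClassicalGeometricVHS) :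
    PeriodDeficiency.Assembly ↔ PeriodDeficiency.GenericityReduction :=
  ⟨periodDeficiency_genericityReduction_of_assembly,
    fun hG => periodDeficiency_assembly_of_supports hC hG⟩

/-- **Cross-route edge: `PeriodsPolice.QbarDescent → Assembly`.**  The item `QbarDescent` of route
`HodgeConjecture/PeriodsPolice` is `HC(ℚ̄) → HodgeConjecture` with antecedent verbatim this route's
`HodgeConjectureQbar`; it implies `Assembly` by ignoring `QbarGenericIsHodgeGeneric` (pure logic).
So a direct proof of `QbarDescent` closes this item, and a refutation of `Assembly` would refute
`QbarDescent` (and `HodgeConjecture`). -/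
theorem periodDeficiency_assembly_of_periodsPolice_qbarDescent (h : PeriodsPolice.QbarDescent) :
    PeriodDeficiency.Assembly := by
  unfold PeriodDeficiency.Assembly PeriodDeficiency.HodgeConjectureQbar
  intro _ hQ
  exact h hQ

/-! ### The real-carrier closing with Lang's fact and `HodgeModelsExist` discharged -/

/-- **The route closes over real carriers from TWO printed facts, the real-carrier BKU statement,
the real-carrier crux 4 and `HC(ℚ̄)`.**  This is the tree's
`hodgeConjecture_of_realCarrier_genericity` (no `BettiHodgeData`, no `GeometricVHSData`, no
`ClassicalGeometricVHS`: the Hodge structures of the fibres are `HodgeModel.hodgeStructure` of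
chosen Hodge-symmetric Hodge models, which exist by `exists_isReal_hodgeModel_holds`) with two of
its hypotheses discharged: Lang's descent `lang1958_isDefinedOverQbar_descends`, used only through
"the `ℚ̄`-Zariski closure of a point over the generic point is everything", is the proved
`qbarGeneric_of_closure_base_pt_eq_univ` (conjugates of a generic complex point are Zariski dense,
`QbarGenericPointsDense`); `HodgeModelsExist` is the theorem `nonempty_hodgeModel_holds`
(`periodDeficiency_hodgeModelsExist_proof`).  Remaining hypotheses: `hSp` spreading out
(Charles–Schnell §11.3.5), `hV` Voisin's mechanism (Voisin 2007, proof of Prop. 1.7), `hBr` the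
real-carrier BKU statement (maximal Mumford–Tate rank ⇒ finite monodromy orbit of rational `(p,p)`
classes, Baldi–Klingler–Ullmo §3.2), `hG` the real-carrier crux 4 (the Mumford–Tate rank at `s` is
maximal on the `ℚ̄`-Zariski closure of `s`), `hQ = HodgeConjectureQbar`.  A real-carrier
restatement `HGQ′ → HodgeConjectureQbar → HodgeConjecture` of the assembly item therefore rests on
`hSp`, `hV`, `hBr` only. [cite: Voisin2007HodgeLoci, Prop. 0.7 and §3 (proof of Prop. 1.7)]
[cite: CharlesSchnell2014Notes, §11.3.5 and Thm. 11.3.19] [cite: BaldiKlinglerUllmo2024, §3.2] -/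
theorem hodgeConjecture_of_realCarrier_genericity_of_two_facts
    (hSp : spreadingOut_smoothProjective_qbarFamily)
    (hV : voisin2007_algebraic_of_finite_monodromyOrbit_of_qbar)
    (hBr : ∀ [HodgeTensorFacts.{0, 0}] (σ : AlgebraicClosure ℚ →+* ℂ)
      ⦃𝒳₀ S₀ : SchemeOver (AlgebraicClosure ℚ)⦄ (f₀ : 𝒳₀ ⟶ S₀) (n p : ℕ)
      (hf : IsSmoothProjectiveFamily ((baseChangeHom σ).map f₀) n),
      IsQuasiProjectiveOver 𝒳₀ → IsQuasiProjectiveOver S₀ → IrreducibleSpace S₀.left →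
      AlgebraicGeometry.Smooth S₀.hom →
      ∀ (A : ∀ t : ComplexPoints ((baseChangeHom σ).obj S₀),
          HodgeModel n (fiberOver ((baseChangeHom σ).map f₀) t))
        (hA : ∀ t, (A t).IsHodgeSymmetric)
        [∀ t, Module.Finite ℚ
          (singularCohomology ℚ ℚ (ComplexPoints (fiberOver ((baseChangeHom σ).map f₀) t)) (2 * p))]
        (s : ComplexPoints ((baseChangeHom σ).obj S₀)),
        (∀ t, ((A t).hodgeStructure (hf.isSmoothProjective t) (hA t) (2 * p)).mtRank ≤
            ((A s).hodgeStructure (hf.isSmoothProjective s) (hA s) (2 * p)).mtRank) →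
        ∀ (α : complexBetti (fiberOver ((baseChangeHom σ).map f₀) s) (2 * p)),
          IsRationalClass α →
          IsOfHodgeType n (fiberOver ((baseChangeHom σ).map f₀) s) (2 * p) p p α →
            {β : complexBetti (fiberOver ((baseChangeHom σ).map f₀) s) (2 * p) |
                ∃ γ : Path s s, IsContinuationAlong γ α β}.Finite)
    (hG : ∀ [HodgeTensorFacts.{0, 0}] (σ : AlgebraicClosure ℚ →+* ℂ)
      ⦃𝒳₀ S₀ : SchemeOver (AlgebraicClosure ℚ)⦄ (f₀ : 𝒳₀ ⟶ S₀) (n i : ℕ)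
      (hf : IsSmoothProjectiveFamily ((baseChangeHom σ).map f₀) n),
      IrreducibleSpace S₀.left → AlgebraicGeometry.Smooth S₀.hom →
      ∀ (A : ∀ t : ComplexPoints ((baseChangeHom σ).obj S₀),
          HodgeModel n (fiberOver ((baseChangeHom σ).map f₀) t))
        (hA : ∀ t, (A t).IsHodgeSymmetric)
        [∀ t, Module.Finite ℚ
          (singularCohomology ℚ ℚ (ComplexPoints (fiberOver ((baseChangeHom σ).map f₀) t)) i)]
        (s : ComplexPoints ((baseChangeHom σ).obj S₀)),
        ∀ t ∈ ⋂₀ {Z | IsDefinedOverQbar σ S₀ Z ∧ s ∈ Z},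
          ((A t).hodgeStructure (hf.isSmoothProjective t) (hA t) i).mtRank ≤
            ((A s).hodgeStructure (hf.isSmoothProjective s) (hA s) i).mtRank)
    (hQ : PeriodDeficiency.HodgeConjectureQbar) :
    _root_.HodgeConjecture := by
  intro n X hX
  obtain ⟨σ⟩ := exists_ringHom_algebraicClosure_rat_complex
  obtain ⟨𝒳₀, S₀, f₀, s, h𝒳₀, hS₀, hirr, hsm, hf, hgen, ⟨e⟩⟩ := hSp σ hX
  have hXs : IsSmoothProjective n (fiberOver ((baseChangeHom σ).map f₀) s) :=
    hf.isSmoothProjective s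
  haveI : HodgeTensorFacts.{0, 0} := hodgeTensorFacts_holds
  haveI : LocallyOfFiniteType S₀.hom := locallyOfFiniteType_of_isQuasiProjectiveOver hS₀
  -- Hodge-symmetric Hodge models of all fibres (chosen)
  choose A hA using fun t : ComplexPoints ((baseChangeHom σ).obj S₀) ↦
    exists_isReal_hodgeModel_holds.exists_isHodgeSymmetric (hf.isSmoothProjective t)
  -- the cycle part of the Hodge conjecture for the fibre `𝒳_s`
  have hfib : ∀ (p : ℕ) (α : complexBetti (fiberOver ((baseChangeHom σ).map f₀) s) (2 * p)),
      IsRationalClass α → IsOfHodgeType n (fiberOver ((baseChangeHom σ).map f₀) s) (2 * p) p p α →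
        α ∈ algebraicClasses (fiberOver ((baseChangeHom σ).map f₀) s) p := by
    intro p α hαr hαh
    haveI : ∀ t : ComplexPoints ((baseChangeHom σ).obj S₀), Module.Finite ℚ
        (singularCohomology ℚ ℚ (ComplexPoints (fiberOver ((baseChangeHom σ).map f₀) t)) (2 * p)) :=
      fun t ↦ finite_singularCohomology_rat_complexPoints (hf.isSmoothProjective t) (2 * p)
    -- `s` is Hodge-generic in its `ℚ̄`-Zariski closure, which is everything (generic point)
    have hHG := hG σ f₀ n (2 * p) hf hirr hsm A hA s
    have hW : (⋂₀ {Z | IsDefinedOverQbar σ S₀ Z ∧ s ∈ Z}) =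
        (Set.univ : Set (ComplexPoints ((baseChangeHom σ).obj S₀))) := by
      rw [Set.sInter_eq_univ]
      rintro Z ⟨hZ, hsZ⟩
      exact qbarGeneric_of_closure_base_pt_eq_univ hgen Z hZ hsZ
    rw [hW] at hHG
    -- finite monodromy (BKU on real carriers), then `ℚ̄`-descent of algebraicity (Voisin 2007)
    have hfinOrbit := hBr σ f₀ n p hf h𝒳₀ hS₀ hirr hsm A hA s (fun t ↦ hHG t (Set.mem_univ t))
      α hαr hαh
    exact hV σ f₀ n p h𝒳₀ hS₀ hirr hsm hf s α hαr hαh hfinOrbit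
      (fun m X₀ hX₀ q c hc hh ↦ (hQ σ hX₀).2 q c hc hh)
  -- transport along `e : X ≅ 𝒳_s`; the Hodge model of `X` comes from `nonempty_hodgeModel_holds`
  obtain ⟨A₀⟩ := periodDeficiency_hodgeModelsExist_proof n _ hXs
  refine ⟨⟨A₀.ofIso e⟩, fun p c hc hpp ↦ ?_⟩
  have halg := mem_algebraicClasses_map_of_iso hXs hX e
    (hfib p (singularCohomology.map ℂ ℂ (AlgPoints.mapContinuous (L := ℂ) e.inv) (2 * p) c)
      (hc.map _) (hpp.map_of_iso e.symm))
  rwa [show complexBetti.map e.hom (2 * p)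
      (singularCohomology.map ℂ ℂ (AlgPoints.mapContinuous (L := ℂ) e.inv) (2 * p) c) = c from
    map_hom_map_inv_apply e (2 * p) c] at halg

end Summit.HodgeConjecture.HodgeConjecture.Theorems

end
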